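import Summits.NavierStokesRegularity.NavierStokesRegularity.Theses.Blowup
import Literature.Analysis.FluidPDE.NSUnconditionalUniquenessHolds

/-!
# Refutation of `Blowup.BlowupClayNonuniqueness` (stmt-NavierStokesRegularity-0154): Clay-class non-uniqueness is false

Item `stmt-NavierStokesRegularity-0154` (route `NavierStokesRegularity/Blowup`, support, rank 4) is the
"loophole" statement `¬ X5b`: *some* Fefferman class-(A) solution (jointly `C^∞` on `ℝ³ × [0,∞)`, bounded
energy, nothing else) from a rapidly decaying datum differs, at some time of the common interval, from the
classical Leray–Hopf solution with the same datum.  It is false: `X5b` (`Blowup.BlowupClayUniqueness`,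
stmt-NavierStokesRegularity-0153) is a theorem, proved inside the refutation below from the in-tree discharge of
T. Tao, Anal. PDE 6 (2013) = arXiv:1108.1165, Cor. 11.4 = arXiv Cor. 71, p. 36 ("Let `(u₀,f,T)` be smooth `H¹`
data. Then there is at most one almost smooth finite energy solution `(u,p,u₀,f,T)` with this data and with
normalised pressure"), velocity form: `Literature.Analysis.FluidPDE.tao_unconditional_uniqueness_velocity_holds`
(axioms standard), by the glue the planner predicted: for `t ∈ (0, T)` both the Clay-class `(u, p)` (bridge
`isNavierStokesSolution_and_smooth_iff`, restricted `Ici 0 → Icc 0 t`) and the classical Leray–Hopf `(v, q)`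
(restricted `Ico 0 T → Icc 0 t`) are smooth finite-energy solutions on the CLOSED slab `[0, t] × ℝ³` (energy of
`v` from the Leray–Hopf energy inequality, `IsLerayHopfOn.lintegral_enorm_sq_le`), the Schwartz datum is `H¹`
(`HasRapidSpatialDecay.lintegral_enorm_iteratedFDeriv_sq_lt_top`), so Tao's theorem gives `u t = v t`; `t = 0`
is the initial condition.  Hence `¬¬X5b`.

The positive statements this argument also settles — `BlowupClayUniqueness` (0153), `BlowupX5bViaTaoUniqueness`
(0728), `Assembly2` (0760), `SchwartzDatumH1` (0761) — are prover business (D-0016); the same proof with those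
four as named theorems is attached as item evidence `Refutation.lean` on each of them.  Route review
2026-08-15, refuter seat `refuter-rreview1-NavierStokesRegularity-Blowup-0420b48a-0`.
-/

noncomputable section

namespace Summit.NavierStokesRegularity.NavierStokesRegularity.Theorems

open Set MeasureTheory Filter Topology
open scoped ENNReal ContDiff
open Literature.Analysis.FluidPDE
open Summit.NavierStokesRegularity.NavierStokesRegularity.Theses.Blowup

/-- `‖g‖_{L²} < ∞` from `∫⁻ ‖g‖ₑ² < ∞` (Mathlib bookkeeping between the `ℕ`-power lower integral and
`eLpNorm`). [folklore] -/
private theorem Blowup.eLpNorm_two_lt_top_of_lintegral' {α : Type*} [MeasurableSpace α] {μ : Measure α}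
    {G : Type*} [NormedAddCommGroup G] {g : α → G} (h : ∫⁻ x, ‖g x‖ₑ ^ 2 ∂μ < ⊤) :
    eLpNorm g 2 μ < ⊤ := by
  have h2 := eLpNorm_nnreal_pow_eq_lintegral (f := g) (μ := μ) (p := (2 : NNReal)) two_ne_zero
  simp only [ENNReal.coe_ofNat, NNReal.coe_ofNat, ENNReal.rpow_two] at h2
  rw [← h2] at h
  refine lt_top_iff_ne_top.2 fun htop => ?_
  rw [htop] at h
  simp at h

/-- **A rapidly decaying `C¹` field is in `H¹`** (`u₀ ∈ L²`, `∇u₀ ∈ L²`): Fefferman's decay (4) with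
`K = 4 > 3` makes every `Dⁿu₀` square integrable (`HasRapidSpatialDecay.lintegral_enorm_iteratedFDeriv_sq_lt_top`,
Tao 2013 §1 p. 3 "Schwartz implies `H¹`"); measurability from continuity of `u₀` and of `fderiv ℝ u₀`. [folklore] -/
private theorem Blowup.memLp_two_of_rapidDecay
    {u₀ : EuclideanSpace ℝ (Fin 3) → EuclideanSpace ℝ (Fin 3)} (hdec : HasRapidSpatialDecay u₀)
    (hC1 : ContDiff ℝ 1 u₀) : MemLp u₀ 2 volume ∧ MemLp (fderiv ℝ u₀) 2 volume := by
  have hH : ∀ n : ℕ, ∫⁻ x, ‖iteratedFDeriv ℝ n u₀ x‖ₑ ^ 2 < ⊤ :=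
    hdec.lintegral_enorm_iteratedFDeriv_sq_lt_top (μ := volume)
  have h0 : ∫⁻ x, ‖u₀ x‖ₑ ^ 2 < ⊤ := by
    refine lt_of_le_of_lt (le_of_eq (lintegral_congr fun x => ?_)) (hH 0)
    rw [← ofReal_norm, ← ofReal_norm, norm_iteratedFDeriv_zero]
  have h1 : ∫⁻ x, ‖fderiv ℝ u₀ x‖ₑ ^ 2 < ⊤ := by
    refine lt_of_le_of_lt (le_of_eq (lintegral_congr fun x => ?_)) (hH 1)
    rw [← ofReal_norm, ← ofReal_norm, norm_iteratedFDeriv_one]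
  exact ⟨⟨hC1.continuous.aestronglyMeasurable, Blowup.eLpNorm_two_lt_top_of_lintegral' h0⟩,
    ⟨(hC1.continuous_fderiv one_ne_zero).aestronglyMeasurable,
      Blowup.eLpNorm_two_lt_top_of_lintegral' h1⟩⟩

/-- Refutes `Blowup.BlowupClayNonuniqueness` [refuted-substantive]: non-uniqueness inside Fefferman's
class (A) from a rapidly decaying datum (the "loophole" `¬X5b`, stmt-NavierStokesRegularity-0154) is false,
because `X5b` holds — proved inline from Tao 2013 Cor. 11.4 = in-tree theorem
`tao_unconditional_uniqueness_velocity_holds`: for `0 < t < T` both solutions are smooth finite-energy solutions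
on the closed slab `[0, t] × ℝ³` with the same `H¹` datum, hence `u t = v t`; `t = 0` by the initial conditions;
witness: none needed (`¬¬X5b` from `X5b`).  No cheap repair: every smooth bounded-energy solution from Schwartz
data IS the classical Leray–Hopf one on its interval of existence, so a non-uniqueness statement must leave class
(A) — rough critical data (Coiculescu–Palasek 2025, infinite energy), forcing (Albritton–Brué–Colombo 2022) or
non-smooth solutions (Buckmaster–Vicol 2019) — and then no longer bears on Clay (A).  barrier-candidate: "Clay
class (A) from Schwartz data is a uniqueness class (Tao2011 Cor. 11.4): no refutation of (A) through
non-uniqueness". [cite: Tao2011, Cor. 11.4] -/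
theorem BlowupBlowupClayNonuniqueness_refuted :
    ¬ Summit.NavierStokesRegularity.NavierStokesRegularity.Theses.Blowup.BlowupClayNonuniqueness := by
  intro hnon
  apply hnon
  -- `X5b`: uniqueness of class-(A) solutions against the classical Leray–Hopf solution on `[0, T)`
  intro ν hν u₀ hdec u v p q T hT hu hp hns hbe hcl hLH hv0 t ht
  obtain ⟨ht0, htT⟩ := ht
  rcases ht0.eq_or_lt with h00 | ht0'
  · -- `t = 0`: both slices are the datum
    subst h00
    rw [hns.initial, hv0]
  · -- `0 < t < T`: Tao's unconditional uniqueness on the closed slab `[0, t]`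
    have hclu : IsClassicalNSSolutionOn (Ici 0) ν 0 u p :=
      (isNavierStokesSolution_and_smooth_iff.1 ⟨hns, hu, hp⟩).1
    have hu' : IsClassicalNSSolutionOn (Icc 0 t) ν 0 u p :=
      hclu.mono (fun s hs => hs.1) (uniqueDiffOn_Icc ht0')
    have hv' : IsClassicalNSSolutionOn (Icc 0 t) ν 0 v q :=
      hcl.mono (fun s hs => ⟨hs.1, lt_of_le_of_lt hs.2 htT⟩) (uniqueDiffOn_Icc ht0')
    -- the datum is `C¹` (it is the smooth slice `u 0`) and rapidly decaying, hence `H¹`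
    have hC1 : ContDiff ℝ 1 u₀ := by
      have h := hclu.contDiff_velocity (t := 0) (by simp)
      rw [hns.initial] at h
      exact h.of_le (by norm_cast)
    obtain ⟨hL2, hH1⟩ := Blowup.memLp_two_of_rapidDecay hdec hC1
    -- finite energy of the Clay-class solution on `[0, t]`
    have hEu : ∃ C : ℝ≥0∞, C < ⊤ ∧ ∀ s ∈ Icc 0 t, ∫⁻ x, ‖u s x‖ₑ ^ 2 ≤ C := by
      obtain ⟨C, hC, hb⟩ := hbe
      exact ⟨C, hC, fun s hs => hb s hs.1⟩
    -- finite energy of the Leray–Hopf partner on `[0, t]` (energy inequality from `s = 0`, `f = 0`)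
    have hEv : ∃ C : ℝ≥0∞, C < ⊤ ∧ ∀ s ∈ Icc 0 t, ∫⁻ x, ‖v s x‖ₑ ^ 2 ≤ C :=
      ⟨ENNReal.ofReal (2 * VectorCalculus.kineticEnergy u₀), ENNReal.ofReal_lt_top,
        fun s hs => hLH.lintegral_enorm_sq_le hν.le ⟨hs.1, hs.2.trans htT.le⟩⟩
    exact tao_unconditional_uniqueness_velocity_holds ν t hν ht0' u₀ hL2 hH1 u v p q hu' hv'
      hns.initial hv0 hEu hEv t ⟨ht0, le_rfl⟩

end Summit.NavierStokesRegularity.NavierStokesRegularity.Theorems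

end
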